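import Literature.AnabelianGeometry.SemiGraphs.PSCRamificationSplitInjection
import Literature.AnabelianGeometry.SemiGraphs.PSCVertexQuotientExistenceProofs
import Literature.AnabelianGeometry.SemiGraphs.PrimeExponentComplement
import Mathlib.Tactic.Group
import Mathlib.Topology.Algebra.Group.ClosedSubgroup
import HarnessLib

/-!
# [IUTchI] Rmk. 1.2.3 (iv) bodies (VS), (EX) over the CORRECTED split injection `UnrVerticialSplitInjection'`

Mochizuki, *Inter-universal Teichmüller theory I* [IUTchI], Remark 1.2.3 (iv), kurims manuscript
p. 42 (replacement text for [CombGC] Rmk. 1.4.3, verticial part): "the inclusions `M^unr_G[v] ⊆ M^unr_G`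
determine a split injection `⊕_v M^unr_G[v] ↪ M^unr_G` … the set of vertices of `G` may be
characterized as the set of [nontrivial!] quotients `M^unr-vert_G ↠ M^unr_G[v] ⊗ F_l`".

SUCCESSOR MIGRATION (abc-iut cell, finding F-L3t4g5-1 of abc-iut-L3-t4).  The frozen predicate
`PSCDatum.UnrVerticialSplitInjection` (FACT-LIST row F-1938 `UnrVerticialCharacterizationHolds`) types
the independence of the `M^unr_G[w]` with the EMPTY sum rendered as `⊥` instead of `E = unrAbKer`,
which is FALSE at every one-vertex datum on a nonabelian group (`PSCUnrVerticialOneVertex.lean`); the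
corrected successor `UnrVerticialSplitInjection'` (`PSCRamificationSplitInjection.lean`, abc-iut-L3-t4)
writes `E ⊔ ⨆_{w ≠ v} M^unr_G[w]` inside the closure.  The cell's kernel of [CombGC] Thm. 1.6 (iii)
(rows T16-L13/L16 of `plan/L3/SUBDAG-CombGC-Thm16.md`) consumed the frozen predicate through exactly
three per-datum bodies; this proof-only file RE-PROVES two of them over the SUCCESSOR, for EVERY datum
(no case distinction on the number of vertices is needed):

* `unrVertAbOf_le_closure_pow_of_eq'` — the one place where INDEPENDENCE is used
  (abc-iut-w4-d052's `unrVertAbOf_le_closure_pow_of_eq`): the argument only needs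
  "`b ∈ M^unr_G[v]⁻¹ ∩ B ⇒ b ∈ E`" for a closed `B ⊇ ⨆_{w ≠ v} M^unr_G[w]⁻¹` with `Ker_v ⊆ L_v · B`,
  and `B := (E ⊔ ⨆_{w ≠ v} …)⁻` (the corrected clause) serves verbatim;
* `vertexQuotientKer_ne_unrVertAb'` ("[nontrivial!]") and `vertexSetCharacterization_of_inputs'`
  (body (VS)) over `UnrVerticialSplitInjection'` + `UnrVertAbOfRank`;
* `exists_isElemAbUnrQuotient_inf_eq_vertexQuotientKer_of_complement` — abc-iut-w5-d174's existence
  theorem (body (EX)) with the COMPLEMENT `C` of `M^unr-vert_G` as explicit data (the only part of the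
  split injection it uses), and `exists_isElemAbUnrQuotient_inf_eq_vertexQuotientKer'` over
  `UnrVerticialSplitInjection'` (its complement clause is the frozen one by `unrAbKer_sup_iSup_eq`,
  the vertex `v` in hand making the vertex set nonempty).

Pure profinite group theory over the interface; 0 defs; a FACT row is an assumption label; nothing
here takes a side on [IUTchIII] Cor. 3.12. [cite: Mochizuki2012, IUTchI Rmk 1.2.3(iv) p.42]
[cite: MochizukiCombGC2007, Thm 1.6(iii) p.13]
-/

noncomputable section

namespace Literature.AnabelianGeometry.SemiGraphs

namespace PSCDatum

open scoped Pointwise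
open SemiGraphOfAnabelioids (IsProSigmaCompletion)

universe u

variable {P : Type u} [Group P] [TopologicalSpace P] [IsTopologicalGroup P]

section Compact

variable [CompactSpace P] [T2Space P]

/-! ### 1. The corrected independence clause turns `Ker_v = M^unr-vert_G` into "`M^unr_G[v]` is generated by `E` and `l`-th powers" -/

/-- The CORRECTED independence clause at `v` (`M^unr_G[v]⁻¹ ∩ (E ⊔ ⨆_{w ≠ v} M^unr_G[w]⁻¹)⁻ = E`,
as in `UnrVerticialSplitInjection'`) turns `Ker_v = M^unr-vert_G` into: `M^unr_G[v]` (preimage) is the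
closed subgroup generated by `E^unr_G` and the `l`-th powers of its elements.  Same argument as
abc-iut-w4-d052's `unrVertAbOf_le_closure_pow_of_eq`; valid at one-vertex data too.
[cite: Mochizuki2012, IUTchI Rmk 1.2.3(iv) p.42] -/
theorem unrVertAbOf_le_closure_pow_of_eq' (G : PSCDatum P) {l : ℕ} {v : G.graph.V}
    (hind : G.unrVertAbOf v ⊓
        (G.unrAbKer ⊔ ⨆ w : {w : G.graph.V // w ≠ v}, G.unrVertAbOf w.1).topologicalClosure =
      G.unrAbKer)
    (hEq : G.vertexQuotientKer l v = G.unrVertAb) :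
    G.unrVertAbOf v ≤
      (G.unrAbKer ⊔ Subgroup.closure ((fun g : P => g ^ l) '' (G.unrVertAbOf v : Set P))
        ).topologicalClosure := by
  set A := G.unrVertAbOf v with hA
  set Lt := (G.unrAbKer ⊔ Subgroup.closure ((fun g : P => g ^ l) '' (A : Set P))).topologicalClosure
    with hLt
  set Bt := (G.unrAbKer ⊔ ⨆ w : {w : G.graph.V // w ≠ v}, G.unrVertAbOf w.1).topologicalClosure
    with hBt
  -- `Lt ⊆ A`, `Lt` normal, `A ⊆ Ker_v ⊆ Lt ⊔ Bt`
  have hAc : IsClosed (A : Set P) := Subgroup.isClosed_topologicalClosure _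
  have hLtA : Lt ≤ A := by
    refine Subgroup.topologicalClosure_minimal _ (sup_le (G.unrAbKer_le_unrVertAbOf v)
      ((Subgroup.closure_le _).mpr ?_)) hAc
    rintro _ ⟨g, hg, rfl⟩
    exact pow_mem hg l
  haveI hLtn : Lt.Normal := normal_of_commutator_le
    ((G.commutator_le_unrAbKer.trans le_sup_left).trans (Subgroup.le_topologicalClosure _))
  have hKle : G.vertexQuotientKer l v ≤ Lt ⊔ Bt := by
    have hclosed : IsClosed (((Lt ⊔ Bt : Subgroup P)) : Set P) := by
      rw [Subgroup.normal_mul, ← Set.image_mul_prod]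
      exact (((Subgroup.isClosed_topologicalClosure _).isCompact.prod
        (Subgroup.isClosed_topologicalClosure _).isCompact).image continuous_mul).isClosed
    unfold vertexQuotientKer
    refine Subgroup.topologicalClosure_minimal _ (sup_le (sup_le ?_ ?_) ?_) hclosed
    · exact (le_sup_left.trans (Subgroup.le_topologicalClosure _)).trans le_sup_left
    · exact (le_sup_right.trans (Subgroup.le_topologicalClosure _)).trans le_sup_right
    · exact (le_sup_right.trans (Subgroup.le_topologicalClosure _)).trans le_sup_left
  have hAK : A ≤ G.vertexQuotientKer l v := hEq ▸ G.unrVertAbOf_le_unrVertAb v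
  intro a ha
  have ha' : a ∈ ((Lt ⊔ Bt : Subgroup P) : Set P) := hKle (hAK ha)
  rw [Subgroup.normal_mul] at ha'
  obtain ⟨x, hx, b, hb, rfl⟩ := ha'
  have hbA : b ∈ A := by
    have := mul_mem (inv_mem (hLtA hx)) ha
    rwa [inv_mul_cancel_left] at this
  have hbE : b ∈ G.unrAbKer := by
    rw [← hind]
    exact ⟨hbA, hb⟩
  exact mul_mem hx ((le_sup_left.trans (Subgroup.le_topologicalClosure _) : G.unrAbKer ≤ Lt) hbE)

/-! ### 2. "[nontrivial!]" and body (VS) over the corrected split injection -/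

/-- **[IUTchI] Rmk. 1.2.3 (iv), "[nontrivial!]", over the CORRECTED split injection**: for sturdy `G` of
pro-`Σ` PSC-type on a profinite group with `l ∈ Σ`, granted `UnrVerticialSplitInjection'` (its
independence clause) and the rank `2·genus(v)` of `M^unr_G[v]` (`UnrVertAbOfRank`), the vertex quotient
`M^unr-vert_G ↠ M^unr_G[v] ⊗ F_l` is nontrivial: `Ker_v ≠ M^unr-vert_G`.  (Proof = abc-iut-w4-d052's
`vertexQuotientKer_ne_unrVertAb` with `unrVertAbOf_le_closure_pow_of_eq'`.)
[cite: Mochizuki2012, IUTchI Rmk 1.2.3(iv) p.42] -/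
theorem vertexQuotientKer_ne_unrVertAb' (G : PSCDatum P) (hsplit : G.UnrVerticialSplitInjection')
    (hrank : G.UnrVertAbOfRank) (hGs : G.IsSturdy) {l : ℕ} (hlS : l ∈ G.Sigma) (v : G.graph.V) :
    G.vertexQuotientKer l v ≠ G.unrVertAb := by
  intro hEq
  have hl : l.Prime := G.sigma_prime l hlS
  set A := G.unrVertAbOf v with hA
  set E := G.unrAbKer with hE
  haveI : E.Normal := normal_of_commutator_le G.commutator_le_unrAbKer
  haveI hEn : (E.subgroupOf A).Normal := inferInstance
  obtain ⟨ι, hι⟩ := hrank v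
  have hr : 0 < 2 * G.genus v := by have := hGs v; omega
  obtain ⟨U, hUo, hUne, hUpow⟩ := exists_open_ne_top_pow_mem ⟨0, hr⟩ hι hl hlS
  apply hUne
  -- pull `U` back to `A ⊆ Π` and push into `Π`
  set π : A →* A ⧸ E.subgroupOf A := QuotientGroup.mk' (E.subgroupOf A) with hπ
  set U' : Subgroup A := U.comap π with hU'
  have hU'c : IsClosed (U' : Set A) :=
    Subgroup.isClosed_of_isOpen _ (hUo.preimage (by exact QuotientGroup.continuous_mk))
  have hAc : IsClosed (A : Set P) := Subgroup.isClosed_topologicalClosure _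
  set W : Subgroup P := U'.map A.subtype with hW
  have hWc : IsClosed (W : Set P) := by
    rw [hW, Subgroup.coe_map]
    exact hAc.isClosedEmbedding_subtypeVal.isClosedMap _ hU'c
  -- `E ⊔ ⟨l-th powers of A⟩ ⊆ W`
  have hEW : E ≤ W := by
    intro e he
    refine ⟨⟨e, G.unrAbKer_le_unrVertAbOf v he⟩, ?_, rfl⟩
    change π ⟨e, _⟩ ∈ U
    have : π ⟨e, G.unrAbKer_le_unrVertAbOf v he⟩ = 1 :=
      (QuotientGroup.eq_one_iff _).mpr (by rw [Subgroup.mem_subgroupOf]; exact he)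
    rw [this]; exact one_mem U
  have hLW : Subgroup.closure ((fun g : P => g ^ l) '' (A : Set P)) ≤ W := by
    refine (Subgroup.closure_le _).mpr ?_
    rintro _ ⟨a, ha, rfl⟩
    refine ⟨⟨a, ha⟩ ^ l, ?_, rfl⟩
    change π (⟨a, ha⟩ ^ l) ∈ U
    rw [map_pow]
    exact hUpow _
  have hAL := G.unrVertAbOf_le_closure_pow_of_eq' ((hsplit hGs).1 v) hEq
  have hAW : A ≤ W := hAL.trans (Subgroup.topologicalClosure_minimal _ (sup_le hEW hLW) hWc)
  -- hence `U' = ⊤` and `U = ⊤`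
  rw [eq_top_iff]
  rintro x -
  obtain ⟨a, rfl⟩ := QuotientGroup.mk'_surjective (E.subgroupOf A) x
  obtain ⟨u, hu, hua⟩ := hAW a.2
  have : u = a := Subtype.ext hua
  subst this
  exact hu

/-- **Body (VS) over the corrected split injection** (`G.VertexSetCharacterization` from
`UnrVerticialSplitInjection'` and `UnrVertAbOfRank`): "[nontrivial!]" by
`vertexQuotientKer_ne_unrVertAb'`, hence (abc-iut-w4-d052's `vertexSetCharacterization_of_ne`) the
injectivity of `v ↦ Ker_v`. [cite: Mochizuki2012, IUTchI Rmk 1.2.3(iv) p.42] -/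
theorem vertexSetCharacterization_of_inputs' (G : PSCDatum P)
    (hsplit : G.UnrVerticialSplitInjection') (hrank : G.UnrVertAbOfRank) :
    G.VertexSetCharacterization := by
  intro hGs l hS
  have hlS : l ∈ G.Sigma := by rw [hS]; exact Set.mem_singleton l
  exact ⟨G.vertexQuotientKer_injective_of_ne l
      (fun v => G.vertexQuotientKer_ne_unrVertAb' hsplit hrank hGs hlS v),
    fun v => G.vertexQuotientKer_ne_unrVertAb' hsplit hrank hGs hlS v⟩

/-! ### 3. Body (EX): the elementary abelian quotient attached to a vertex, from a complement of `M^unr-vert_G` -/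

/-- **[IUTchI] Rmk. 1.2.3 (iv), existence of `φ_v : M^unr_G ↠ Q` restricting on `M^unr-vert_G` to the
vertex quotient `M^unr-vert_G ↠ M^unr_G[v] ⊗ F_l`, from a COMPLEMENT of `M^unr-vert_G`** — the only part
of the split injection the construction uses, here explicit data: a closed `C ⊇ E` with
`C ∩ M^unr-vert = E` and `C · M^unr-vert = Π_G` (preimages).  With the rank of `M^unr_G[v]`
(`UnrVertAbOfRank`) and a prime `l ∈ Σ`: `H' := Ker_v · C` is an open normal subgroup containing `E`
and all `l`-th powers, `M^unr-vert · H' = Π` and `M^unr-vert ∩ H' = Ker_v` (abc-iut-w5-d174's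
`exists_isElemAbUnrQuotient_inf_eq_vertexQuotientKer`, its complement made a parameter).
[cite: Mochizuki2012, IUTchI Rmk 1.2.3(iv) p.42] -/
theorem exists_isElemAbUnrQuotient_inf_eq_vertexQuotientKer_of_complement (G : PSCDatum P)
    {C : Subgroup P} (hCc : IsClosed (C : Set P)) (hEC : G.unrAbKer ≤ C)
    (hCA : C ⊓ G.unrVertAb = G.unrAbKer) (hCA' : C ⊔ G.unrVertAb = ⊤)
    (hrank : G.UnrVertAbOfRank) {l : ℕ} (hl : l.Prime) (hlS : l ∈ G.Sigma) (v : G.graph.V) :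
    ∃ H' : Subgroup P, G.IsElemAbUnrQuotient l H' ∧ G.unrVertAb ⊔ H' = ⊤ ∧
      G.unrVertAb ⊓ H' = G.vertexQuotientKer l v := by
  have hA_def : G.unrVertAb = (⨆ w, G.unrVertAbOf w).topologicalClosure := rfl
  -- the vertex kernel `K = Ker_v`, made opaque
  obtain ⟨K, hK⟩ : ∃ K : Subgroup P, G.vertexQuotientKer l v = K := ⟨_, rfl⟩
  have hcommE : ⁅(⊤ : Subgroup P), ⊤⁆ ≤ G.unrAbKer := G.commutator_le_unrAbKer
  have hEK : G.unrAbKer ≤ K := by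
    rw [← hK]
    exact (le_sup_left.trans le_sup_left).trans (Subgroup.le_topologicalClosure _)
  have hKA : K ≤ G.unrVertAb := hK ▸ G.vertexQuotientKer_le_unrVertAb l v
  have hKc : IsClosed (K : Set P) := hK ▸ Subgroup.isClosed_topologicalClosure _
  have hwK : ∀ w : G.graph.V, w ≠ v → G.unrVertAbOf w ≤ K := by
    intro w hw
    rw [← hK]
    refine (Subgroup.le_topologicalClosure _).trans' (le_sup_left.trans' (le_sup_right.trans' ?_))
    exact le_iSup_of_le ⟨w, hw⟩ le_rfl
  have hpowK : ∀ a ∈ G.unrVertAbOf v, a ^ l ∈ K := by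
    intro a ha
    rw [← hK]
    refine Subgroup.le_topologicalClosure _ (Subgroup.mem_sup_right (Subgroup.subset_closure ?_))
    exact ⟨a, ha, rfl⟩
  have hEc : IsClosed (G.unrAbKer : Set P) := Subgroup.isClosed_topologicalClosure _
  haveI hEn : G.unrAbKer.Normal := normal_of_commutator_le hcommE
  haveI hKn : K.Normal := normal_of_commutator_le (hcommE.trans hEK)
  haveI hCn : C.Normal := normal_of_commutator_le (hcommE.trans hEC)
  -- the candidate kernel `H' = K · C`
  haveI hH'n : (K ⊔ C).Normal := Subgroup.sup_normal K C
  have hH'c : IsClosed ((K ⊔ C : Subgroup P) : Set P) := by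
    rw [Subgroup.normal_mul, ← Set.image_mul_prod]
    exact ((hKc.isCompact.prod hCc.isCompact).image continuous_mul).isClosed
  have hcommH' : ⁅(⊤ : Subgroup P), ⊤⁆ ≤ K ⊔ C := (hcommE.trans hEK).trans le_sup_left
  have hsup : G.unrVertAb ⊔ (K ⊔ C) = ⊤ :=
    top_le_iff.mp (hCA'.symm.le.trans (sup_le (le_sup_right.trans le_sup_right) le_sup_left))
  have hinf : G.unrVertAb ⊓ (K ⊔ C) = K := by
    refine le_antisymm ?_ (le_inf hKA le_sup_left)
    rintro x ⟨hxA, hxKC⟩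
    have hx' : x ∈ ((K ⊔ C : Subgroup P) : Set P) := hxKC
    rw [Subgroup.normal_mul] at hx'
    obtain ⟨k, hk, c, hc, rfl⟩ := hx'
    have hcA : c ∈ G.unrVertAb := by
      have := G.unrVertAb.mul_mem (G.unrVertAb.inv_mem (hKA hk)) hxA
      rwa [inv_mul_cancel_left] at this
    have hcE : c ∈ G.unrAbKer := by rw [← hCA]; exact ⟨hc, hcA⟩
    exact K.mul_mem hk (hEK hcE)
  -- every `l`-th power lies in `H'`
  have hpowA : ∀ a ∈ G.unrVertAbOf v, a ^ l ∈ K ⊔ C := fun a ha => Subgroup.mem_sup_left (hpowK a ha)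
  have hpow : ∀ g : P, g ^ l ∈ K ⊔ C := by
    let T : Subgroup P :=
      { carrier := {g : P | g ^ l ∈ K ⊔ C}
        one_mem' := by simp only [Set.mem_setOf_eq, one_pow]; exact one_mem _
        mul_mem' := fun hx hy => PrimeExponent.mul_pow_mem_of_commutator_le hcommH' l hx hy
        inv_mem' := fun hx => by
          simp only [Set.mem_setOf_eq, inv_pow] at hx ⊢
          exact inv_mem hx }
    have hTc : IsClosed (T : Set P) := hH'c.preimage (continuous_id.pow l)
    have hCT : C ≤ T := by
      intro c hc
      show c ^ l ∈ K ⊔ C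
      exact Subgroup.mem_sup_right (pow_mem hc l)
    have hAT : G.unrVertAb ≤ T := by
      rw [hA_def]
      refine Subgroup.topologicalClosure_minimal _ (iSup_le fun w => ?_) hTc
      intro a ha
      show a ^ l ∈ K ⊔ C
      by_cases hw : w = v
      · subst hw
        exact hpowA a ha
      · exact Subgroup.mem_sup_left (pow_mem (hwK w hw ha) l)
    intro g
    have h : C ⊔ G.unrVertAb ≤ T := sup_le hCT hAT
    rw [hCA'] at h
    exact h (Subgroup.mem_top g)
  -- `H'` is open: `Π/H'` is the finite image of `M^unr_G[v]`
  have hopen : IsOpen ((K ⊔ C : Subgroup P) : Set P) := by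
    haveI : IsClosed ((K ⊔ C : Subgroup P) : Set P) := hH'c
    haveI : (G.unrAbKer.subgroupOf (G.unrVertAbOf v)).Normal := inferInstance
    obtain ⟨ι, hι⟩ := hrank v
    have hfin := finite_map_mk_of_pow_mem (A := G.unrVertAbOf v) (Subgroup.isClosed_topologicalClosure _)
      hEc hι hl hlS (H := K ⊔ C) (hEK.trans le_sup_left) hpowA
    have hsub : (Set.univ : Set (P ⧸ (K ⊔ C))) ⊆
        ((G.unrVertAbOf v).map (QuotientGroup.mk' (K ⊔ C)) : Set (P ⧸ (K ⊔ C))) := by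
      intro q _
      obtain ⟨g, rfl⟩ := QuotientGroup.mk_surjective q
      have hg : g ∈ ((G.unrVertAb ⊔ (K ⊔ C) : Subgroup P) : Set P) := by
        rw [hsup]; exact Subgroup.mem_top g
      rw [Subgroup.mul_normal] at hg
      obtain ⟨a, ha, h, hh, rfl⟩ := hg
      have e1 : (QuotientGroup.mk (a * h) : P ⧸ (K ⊔ C)) = QuotientGroup.mk a := by
        rw [QuotientGroup.mk_mul, (QuotientGroup.eq_one_iff h).mpr hh, mul_one]
      rw [e1]
      -- `mk a ∈ closure (mk '' ⨆ A_w) ⊆ mk '' A_v` (a finite, hence closed, set)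
      have h1 : (QuotientGroup.mk a : P ⧸ (K ⊔ C)) ∈
          closure ((QuotientGroup.mk : P → P ⧸ (K ⊔ C)) ''
            ((⨆ w, G.unrVertAbOf w : Subgroup P) : Set P)) := by
        refine image_closure_subset_closure_image QuotientGroup.continuous_mk ⟨a, ?_, rfl⟩
        rw [hA_def] at ha
        exact ha
      have h2 : (QuotientGroup.mk : P → P ⧸ (K ⊔ C)) '' ((⨆ w, G.unrVertAbOf w : Subgroup P) : Set P) ⊆
          ((G.unrVertAbOf v).map (QuotientGroup.mk' (K ⊔ C)) : Set (P ⧸ (K ⊔ C))) := by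
        rw [← QuotientGroup.coe_mk', ← Subgroup.coe_map, SetLike.coe_subset_coe, Subgroup.map_iSup]
        refine iSup_le fun w => ?_
        by_cases hw : w = v
        · subst hw; exact le_rfl
        · rw [(Subgroup.map_eq_bot_iff _).mpr (by rw [QuotientGroup.ker_mk']; exact (hwK w hw).trans le_sup_left)]
          exact bot_le
      exact closure_minimal h2 hfin.isClosed h1
    haveI : Finite (P ⧸ (K ⊔ C)) := Set.finite_univ_iff.mp (hfin.subset hsub)
    haveI : (K ⊔ C).FiniteIndex := Subgroup.finiteIndex_of_finite_quotient
    exact Subgroup.isOpen_of_isClosed_of_finiteIndex _ hH'c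
  rw [hK]
  exact ⟨K ⊔ C, ⟨hH'n, hopen, hEK.trans le_sup_left, hpow⟩, hsup, hinf⟩

/-- **Body (EX) over the corrected split injection `UnrVerticialSplitInjection'`**: for sturdy `G` on a
profinite group, a prime `l ∈ Σ` and every vertex `v`, there is an elementary abelian quotient of
`M^unr_G` restricting on `M^unr-vert_G` to the vertex quotient at `v`.  The successor's complement clause
is stated against `E ⊔ ⨆_w M^unr_G[w]`, which equals `⨆_w M^unr_G[w]` because the vertex set
contains `v` (`unrAbKer_sup_iSup_eq`). [cite: Mochizuki2012, IUTchI Rmk 1.2.3(iv) p.42] -/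
theorem exists_isElemAbUnrQuotient_inf_eq_vertexQuotientKer' (G : PSCDatum P)
    (hsplit : G.UnrVerticialSplitInjection') (hrank : G.UnrVertAbOfRank) (hGs : G.IsSturdy)
    {l : ℕ} (hl : l.Prime) (hlS : l ∈ G.Sigma) (v : G.graph.V) :
    ∃ H' : Subgroup P, G.IsElemAbUnrQuotient l H' ∧ G.unrVertAb ⊔ H' = ⊤ ∧
      G.unrVertAb ⊓ H' = G.vertexQuotientKer l v := by
  obtain ⟨-, C, hCc, hEC, hCA, hCA'⟩ := hsplit hGs
  haveI : Nonempty G.graph.V := ⟨v⟩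
  rw [G.unrAbKer_sup_iSup_eq] at hCA hCA'
  exact G.exists_isElemAbUnrQuotient_inf_eq_vertexQuotientKer_of_complement hCc hEC hCA hCA' hrank
    hl hlS v

end Compact

end PSCDatum

end Literature.AnabelianGeometry.SemiGraphs

end
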